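import Literature.Geometry.Lorentzian.KerrIntegratedDecayNearExtremalReduction
import Literature.Geometry.Lorentzian.KerrAdmissibleWaveDataEnergy
import HarnessLib

/-!
# Future integrability of admissible Kerr waves at every order, from the every-order / zeroth-order
# form of Dafermos–Rodnianski–Shlapentokh-Rothman's integrated decay (Thm. 3.1 (24) ∧ Thm. 3.2 (25))

(family `gr`, infrastructure for **gr.S24** and the `κ`-explicit programme near extremality;
namespaces `Literature.Geometry.Lorentzian`, `Literature.Geometry.Lorentzian.Kerr`)

The `κ`-explicit integrated-decay programme near extremality (crux
`PhaseMixingCapture.KappaExplicitWaveDecay` of the summit `FinalStateConjecture`, stub S6a′) runs DRSR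
§9 (arXiv:1402.7034) for FUTURE-INTEGRABLE waves: those whose local coordinate Sobolev energies of
every order, zeroth order included, are time-integrable on every coordinate ball,
`∫₀^∞ 𝓔_k(τ; ‖y‖ ≤ A) dτ < ∞` (the tree's proxy for "`ξ(τ)ψ` is sufficiently integrable", DRSR
Def. 5.1.1 / 9.1.1). At a FIXED sub-extremal spin this is, qualitatively, DRSR's Prop. 11.1 with
Thm. 3.1 (24) (zeroth order) and Thm. 3.2 (25) (every order). This file derives it from the vendored
every-order form of (24) ∧ (25) — the body of the named fact
`DafermosRodnianskiShlapentokhRothman2016_integratedDecayZeroth_uniform` of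
`KerrIntegratedDecayZerothUniform.lean`, written out here as a HYPOTHESIS so that no definition is
introduced and nothing is claimed about it:

* `Kerr.exists_admissibleOn_heightFn` — **the `a`-uniform Dafermos–Rodnianski graph**: for `M > 0`
  there is `l₀ > 0` such that for every `l ≥ l₀` the height function `heightFn M l`
  (`KerrWaveEnergy.lean`; `= 0` on `{‖y‖ ≤ l}`, `2M log`-bent far out, slope `≤ 1/4`) is admissible
  and, for every sub-extremal `a`, every admissible wave `φ` (data compactly supported on the leaf
  `{t*_KS = 0}`) has compactly supported data on its graph with far graph energy
  `E^far_F[φ](0) ≤ 8 · sliceEnergy φ 0` (finite speed of propagation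
  `kerr_far_finite_speed_of_propagation` and the far `J^T` identity
  `kerr_far_TEnergy_comparison_of_farRadius_le`; this is the block `key` written inline in
  `drsr_wave_integrated_decay_kerr_of_DRSR` and `kerr_nearExtremal_integratedDecay_of_graphILED`,
  extracted once and for all, with the `a`-free scale `max (4A, 4Ms, 293M + 2)`);
* `futureIntegrable_of_integratedDecayZeroth` — **future integrability at every order**: under the
  every-order fact, for sub-extremal `(M, a)`, every admissible wave `ψ` and all `k`, `A`:
  `∫₀^∞ sliceSobolevEnergy … ψ τ k 0 (closedBall 0 A) dτ < ∞`. Proof: the fact at `a₀ := |a|`,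
  `j := k` on the graph of `heightFn M l`, `l = max (l₀, R₀, A)`; the right-hand side is finite by
  `IsAdmissibleKerrWave.sliceSobolevEnergy_lt_top` (order `k + 1`, `KerrAdmissibleWaveDataEnergy.lean`)
  and `E^far_F[T^iψ](0) ≤ 8 sliceEnergy (T^iψ) 0 ≤ 32 E_{k+1}[ψ](0)`
  (`IsAdmissibleKerrWave.timeDeriv_iterate`, `sliceEnergy_timeDeriv_iterate_le`).

## References

* M. Dafermos, I. Rodnianski, Y. Shlapentokh-Rothman, Ann. of Math. 183 (2016) = arXiv:1402.7034,
  Thm. 3.1 (24), Thm. 3.2 (25), §3.3, Def. 5.1.1, Def. 9.1.1, Prop. 11.1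
  (key `DafermosRodnianskiShlapentokhrothman2014`).
* M. Dafermos, I. Rodnianski, arXiv:1010.5132, §4.6 Prop. 4.6.1 (key `DafermosRodnianski2010KerrSmallA`).
-/

noncomputable section

namespace Literature.Geometry.Lorentzian

open MeasureTheory Filter Set TopologicalSpace Metric
open scoped Topology Manifold ENNReal ContDiff

/-! ### The `a`-uniform Dafermos–Rodnianski graph -/

/-- **The `a`-uniform Dafermos–Rodnianski graph.** For `M > 0` there is `l₀ > 0` such that for
every `l ≥ l₀`: `heightFn M l` is an admissible height function vanishing on `{‖y‖ ≤ l}`, and for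
every sub-extremal `a` every admissible wave `φ` on `(M, a)` (data compactly supported on the leaf
`{t*_KS = 0}`) has compactly supported data on the graph `{t*_KS = heightFn M l}` with
`graphSliceEnergyOn … φ (heightFn M l) 0 {l < ‖y‖} ≤ 8 · sliceEnergy … φ 0`. The scale is
`l₀ = max (4A, 4Ms, 293M + 2)` with `A = 4MB + 2M`, `B` a bound for `|heightProfile'|` and `s` the
coarse propagation speed; finite speed of propagation (`kerr_far_finite_speed_of_propagation`) makes
`φ, dφ` vanish on `{x⁰ ≥ 0, ‖x⃗‖ > ρ + s x⁰}`, whence compact support on the graph and vanishing on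
the wedge `{0 ≤ x⁰ ≤ F}` beyond `2ρ + 1`, and the far `J^T` identity
(`kerr_far_TEnergy_comparison_of_farRadius_le`, `R_far ≤ 293M + 2`) gives the factor `8`. This is the
argument of Dafermos–Rodnianski, arXiv:1010.5132, §4.6, Prop. 4.6.1.
[cite: DafermosRodnianski2010KerrSmallA, §4.6 Prop. 4.6.1] -/
theorem Kerr.exists_admissibleOn_heightFn {M : ℝ} (hM : 0 < M) :
    ∃ l₀ : ℝ, 0 < l₀ ∧ ∀ l : ℝ, l₀ ≤ l →
      Kerr.IsAdmissibleHeight M (heightFn M l) ∧ (∀ y : E3, ‖y‖ ≤ l → heightFn M l y = 0) ∧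
      ∀ [Kerr.Facts] [Kerr.SliceFacts] (a : ℝ), Kerr.IsSubextremal M a →
        ∀ φ : Kerr.exterior M a → ℝ, IsAdmissibleKerrWave M a φ →
          IsAdmissibleKerrWaveOn M a (heightFn M l) φ ∧
            graphSliceEnergyOn (Kerr.exterior M a) φ (heightFn M l) 0 {y | l < ‖y‖} ≤
              8 * sliceEnergy (Kerr.exterior M a) φ 0 := by
  obtain ⟨s, hs1, hCfar⟩ := kerr_far_finite_speed_of_propagation
  have hs0 : 0 ≤ s := zero_le_one.trans hs1
  obtain ⟨B, hB0, hBd⟩ := exists_bound_deriv_heightProfile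
  set A : ℝ := 4 * M * B + 2 * M with hA_def
  have hA0 : 0 ≤ A := by positivity
  set l₀ : ℝ := max (max (4 * A) (4 * M * s)) (293 * M + 2) with hl₀_def
  have hl₀ : 0 < l₀ := (by positivity : (0 : ℝ) < 293 * M + 2).trans_le (le_max_right _ _)
  refine ⟨l₀, hl₀, fun l hl ↦ ?_⟩
  have hl_A : 4 * A ≤ l := ((le_max_left _ _).trans (le_max_left _ _)).trans hl
  have hl_s : 4 * M * s ≤ l := ((le_max_right _ _).trans (le_max_left _ _)).trans hl
  have hl_unif : 293 * M + 2 ≤ l := (le_max_right _ _).trans hl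
  have hl0 : 0 < l := hl₀.trans_le hl
  set F : E3 → ℝ := heightFn M l with hF_def
  have hF_smooth : ContDiff ℝ ∞ F := contDiff_heightFn M l
  have hF_C1 : ContDiff ℝ 1 F := hF_smooth.of_le (ENat.natCast_le_of_coe_top_le_withTop le_rfl 1)
  have hF_slope : ∀ y : E3, ‖fderiv ℝ F y‖ ≤ 1 / 4 := by
    intro y
    have h := norm_fderiv_heightFn_le_div hM.le hl0 hB0 hBd y
    have h2 : A / l ≤ 1 / 4 := by
      rw [div_le_iff₀ hl0]; linarith
    rw [← hA_def] at h
    linarith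
  have hF_zero : ∀ y : E3, ‖y‖ ≤ l → F y = 0 := fun y hy ↦ heightFn_of_norm_le hl0 hy
  have hF_nonneg : ∀ y : E3, 0 ≤ F y := heightFn_nonneg hM.le l
  have hF_sF : ∀ y : E3, s * F y ≤ ‖y‖ / 2 := by
    intro y
    have h := heightFn_le hM.le hl0 y
    have h1 : s * F y ≤ s * (2 * M * ‖y‖ / l) := mul_le_mul_of_nonneg_left h hs0
    have h2 : s * (2 * M * ‖y‖ / l) ≤ ‖y‖ / 2 := by
      rw [← mul_div_assoc, div_le_div_iff₀ hl0 (by norm_num : (0:ℝ) < 2)]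
      nlinarith [norm_nonneg y]
    exact h1.trans h2
  have hF_adm : Kerr.IsAdmissibleHeight M F :=
    ⟨hF_smooth, ⟨3 / 4, by norm_num, fun y ↦ by linarith [hF_slope y]⟩, _,
      tendsto_heightFn_sub_log hl0⟩
  have hzero_C1 : ContDiff ℝ 1 (0 : E3 → ℝ) := contDiff_const
  have hzero_slope : ∀ y : E3, ‖fderiv ℝ (0 : E3 → ℝ) y‖ ≤ 1 / 4 := by
    intro y; simp
  refine ⟨hF_adm, hF_zero, fun a hMa φ hφ ↦ ?_⟩
  -- ### a sub-extremal spin: far radius below the uniform scale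
  have hl_far : Kerr.farRadius M a ≤ l := (Kerr.farRadius_le_of_isSubextremal hMa).trans hl_unif
  have hl_af : Kerr.afRadius a (Kerr.rPlus M a) < l :=
    (Kerr.afRadius_lt_farRadius M a).trans_le hl_far
  obtain ⟨hsmooth, hsol, K, hK, hdata⟩ := hφ
  obtain ⟨ρ₀, -, hρ₀⟩ := exists_spatialNorm_le_of_isCompact hK
  set ρ : ℝ := max ρ₀ (Kerr.farRadius M a) with hρ_def
  have hρfar : Kerr.farRadius M a ≤ ρ := le_max_right _ _
  have hρ0 : 0 ≤ ρ := (Kerr.farRadius_pos M a).le.trans hρfar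
  have hρ : ∀ x ∈ K, E4.spatialNorm (x : E4) ≤ ρ := fun x hx ↦
    (hρ₀ x hx).trans (le_max_left _ _)
  -- finite speed of propagation (far region, speed `s`)
  have hvan : ∀ x : Kerr.exterior M a, 0 ≤ (x : E4) 0 →
      ρ + s * (x : E4) 0 < E4.spatialNorm (x : E4) →
      φ x = 0 ∧ mfderiv 𝓘(ℝ, E4) 𝓘(ℝ, ℝ) φ x = 0 := by
    refine hCfar M a hMa φ hsmooth hsol ρ hρfar fun x hx0 hxρ ↦ hdata x hx0 fun hxK ↦ ?_
    exact absurd (hρ x hxK) (not_le.mpr hxρ)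
  -- `φ` has compactly supported data on the graph of `F`
  have hφF : IsAdmissibleKerrWaveOn M a F φ := by
    refine ⟨hsmooth, hsol, ?_⟩
    set B₂ : Set E4 := (fun y : E3 ↦ E4.ofTimeSpace (F y) y) '' {y | l ≤ ‖y‖ ∧ ‖y‖ ≤ 2 * ρ}
      with hB₂_def
    have hB₂c : IsCompact B₂ := by
      refine IsCompact.image ?_ ?_
      · have : {y : E3 | l ≤ ‖y‖ ∧ ‖y‖ ≤ 2 * ρ} =
            {y | l ≤ ‖y‖} ∩ Metric.closedBall 0 (2 * ρ) := by
          ext y; simp [Metric.mem_closedBall, dist_zero_right]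
        rw [this]
        exact (isCompact_closedBall _ _).inter_left
          (isClosed_le continuous_const continuous_norm)
      · exact E4.continuous_ofTimeSpace' hF_smooth.continuous continuous_id
    have hB₂sub : B₂ ⊆ (Kerr.exterior M a : Set E4) := by
      rintro _ ⟨y, ⟨hy1, _⟩, rfl⟩
      exact Kerr.ofTimeSpace_mem_exterior_iff.mpr
        (Kerr.mem_slice_of_lt_norm (hl_af.trans_le hy1))
    set K' : Set (Kerr.exterior M a) := K ∪ Subtype.val ⁻¹' B₂ with hK'_def
    have hK'c : IsCompact K' := by
      refine hK.union ?_
      have hrange : B₂ ⊆ Set.range (Subtype.val : Kerr.exterior M a → E4) :=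
        fun x hx ↦ ⟨⟨x, hB₂sub hx⟩, rfl⟩
      rw [Topology.IsEmbedding.subtypeVal.isCompact_iff, Set.image_preimage_eq_of_subset hrange]
      exact hB₂c
    refine ⟨K', hK'c, fun x hx0 hxK' ↦ ?_⟩
    set y : E3 := E4.spatial (x : E4) with hy_def
    have hxy : (x : E4) = E4.ofTimeSpace (F y) y := by rw [← hx0]; exact eq_ofTimeSpace _
    have hsn : E4.spatialNorm (x : E4) = ‖y‖ := rfl
    by_cases hfar : 2 * ρ < ‖y‖
    · refine hvan x (hx0 ▸ hF_nonneg y) ?_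
      rw [hsn, hx0]
      have hh := hF_sF y
      nlinarith [hF_nonneg y]
    · push Not at hfar
      by_cases hnear : l ≤ ‖y‖
      · exact absurd (Or.inr ⟨y, ⟨hnear, hfar⟩, hxy.symm⟩ : x ∈ K') hxK'
      · push Not at hnear
        have h0 : (x : E4) 0 = 0 := by rw [hx0, hF_zero y hnear.le]
        exact hdata x h0 fun hxK ↦ hxK' (Or.inl hxK)
  refine ⟨hφF, ?_⟩
  -- the far `J^T` identity between the leaf `{t* = 0}` and the graph of `F` (a theorem)
  have hB := kerr_far_TEnergy_comparison_of_farRadius_le hMa hl_far (F₁ := 0) (F₂ := F)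
    hzero_C1 hF_C1 hzero_slope hF_slope (fun y hy ↦ by simp [hF_zero y hy])
    (fun y ↦ by simpa using hF_nonneg y) φ 0 hsmooth hsol
    ⟨2 * ρ + 1, fun x hx1 hx2 hx3 ↦ by
      simp only [Pi.zero_apply, add_zero] at hx1
      simp only [zero_add] at hx2
      refine hvan x hx1 ?_
      have hsn : E4.spatialNorm (x : E4) = ‖E4.spatial (x : E4)‖ := rfl
      have hh := hF_sF (E4.spatial (x : E4))
      have h2 := mul_le_mul_of_nonneg_left hx2 hs0
      rw [hsn] at hx3 ⊢
      nlinarith⟩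
  calc graphSliceEnergyOn (Kerr.exterior M a) φ F 0 {y | l < ‖y‖}
      ≤ 8 * graphSliceEnergyOn (Kerr.exterior M a) φ 0 0 {y | l < ‖y‖} := hB.1
    _ ≤ 8 * graphSliceEnergy (Kerr.exterior M a) φ 0 0 := by
        gcongr
        exact graphSliceEnergyOn_le _ _ _ _ _
    _ = 8 * sliceEnergy (Kerr.exterior M a) φ 0 := by rw [graphSliceEnergy_zero_height]

/-! ### Future integrability at every order -/

/-- **Future integrability of admissible waves at every order, from the every-order / zeroth-order
form of DRSR Thm. 3.1 (24) ∧ Thm. 3.2 (25).** HYPOTHESIS (written out; it is the body of the named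
fact `DafermosRodnianskiShlapentokhRothman2016_integratedDecayZeroth_uniform` of
`KerrIntegratedDecayZerothUniform.lean`): for `0 ≤ a₀ < M` and every `j` there is `R₀ > 0` such that
for admissible `F` flat on `{‖y‖ ≤ ρ}`, `ρ ≥ R₀`, and `R ≤ ρ`, some `C < ∞` gives for all `|a| ≤ a₀`
and all `ψ` with compactly supported data on the graph
`∫₀^∞ 𝓔_j(τ, R) dτ ≤ C (𝓔_{j+1}[ψ](flat ball) + ∑_{i ≤ j} E^far_F[T^iψ](0))`. CONCLUSION: for every
sub-extremal `(M, a)`, every admissible wave `ψ` (data compactly supported on the leaf `{t*_KS = 0}`)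
and all `k`, `A`: `∫₀^∞ sliceSobolevEnergy … ψ τ k 0 (closedBall 0 A) dτ < ∞` — the local
coordinate Sobolev energies of every order, zeroth order included, are time-integrable on every
coordinate ball (DRSR's "future-integrable", Def. 9.1.1 with Def. 5.1.1, at a fixed spin: Prop. 11.1
with (24), (25)). Proof: the hypothesis at `a₀ := |a|`, `j := k`, on the Dafermos–Rodnianski graph
`heightFn M l`, `l = max (l₀, R₀, A)` (`Kerr.exists_admissibleOn_heightFn`), `R := A`; its right-hand
side is finite: `𝓔_{k+1}(ball) ≤ E_{k+1}[ψ](0) < ∞` (`IsAdmissibleKerrWave.sliceSobolevEnergy_lt_top`)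
and `E^far_F[T^iψ](0) ≤ 8 sliceEnergy (T^iψ) 0 ≤ 32 E_{k+1}[ψ](0)` for `i ≤ k`
(`IsAdmissibleKerrWave.timeDeriv_iterate`, `sliceEnergy_timeDeriv_iterate_le`).
[cite: DafermosRodnianskiShlapentokhrothman2014, Prop. 11.1; Thm. 3.1 (24); Thm. 3.2 (25); Def. 9.1.1] -/
theorem futureIntegrable_of_integratedDecayZeroth
    (h : ∀ [Kerr.Facts] [Kerr.SliceFacts] (M a₀ : ℝ), 0 ≤ a₀ → a₀ < M → ∀ j : ℕ,
      ∃ R₀ : ℝ, 0 < R₀ ∧ ∀ (F : E3 → ℝ) (ρ : ℝ), Kerr.IsAdmissibleHeight M F → R₀ ≤ ρ →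
        (∀ y : E3, ‖y‖ ≤ ρ → F y = 0) → ∀ R : ℝ, R ≤ ρ →
        ∃ C : ℝ≥0∞, C < ⊤ ∧ ∀ a : ℝ, |a| ≤ a₀ →
          ∀ ψ : Kerr.exterior M a → ℝ, IsAdmissibleKerrWaveOn M a F ψ →
          ∫⁻ τ in Ioi (0 : ℝ), sliceSobolevEnergy (Kerr.exterior M a) ψ τ j 0 (closedBall (0 : E3) R) ≤
            C * (sliceSobolevEnergy (Kerr.exterior M a) ψ 0 (j + 1) 0 (closedBall (0 : E3) ρ) +
              ∑ i ∈ Finset.range (j + 1),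
                graphSliceEnergyOn (Kerr.exterior M a) (timeDeriv^[i] ψ) F 0 {y | ρ < ‖y‖}))
    [Kerr.Facts] [Kerr.SliceFacts] {M a : ℝ} (hMa : Kerr.IsSubextremal M a)
    {ψ : Kerr.exterior M a → ℝ} (hψ : IsAdmissibleKerrWave M a ψ) (k : ℕ) (A : ℝ) :
    ∫⁻ τ in Ioi (0 : ℝ), sliceSobolevEnergy (Kerr.exterior M a) ψ τ k 0 (closedBall (0 : E3) A) < ⊤ := by
  have hM : 0 < M := hMa.pos
  have ha : |a| < M := hMa
  obtain ⟨R₀, hR₀, h'⟩ := h M |a| (abs_nonneg a) ha k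
  obtain ⟨l₀, hl₀, hgraph⟩ := Kerr.exists_admissibleOn_heightFn hM
  set l : ℝ := max l₀ (max R₀ A) with hl_def
  have hl₀l : l₀ ≤ l := le_max_left _ _
  have hR₀l : R₀ ≤ l := (le_max_left _ _).trans (le_max_right _ _)
  have hAl : A ≤ l := (le_max_right _ _).trans (le_max_right _ _)
  obtain ⟨hF_adm, hF_zero, hkey⟩ := hgraph l hl₀l
  set F : E3 → ℝ := heightFn M l with hF_def
  obtain ⟨C, hC, hCψ⟩ := h' F l hF_adm hR₀l hF_zero A hAl
  obtain ⟨hψF, -⟩ := hkey a hMa ψ hψ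
  -- the right-hand side is finite
  set S : ℝ≥0∞ := sliceSobolevEnergy (Kerr.exterior M a) ψ 0 (k + 1) 0 univ with hS_def
  have hS : S < ⊤ := hψ.sliceSobolevEnergy_lt_top hM.le (k + 1)
  have h1 : sliceSobolevEnergy (Kerr.exterior M a) ψ 0 (k + 1) 0 (closedBall (0 : E3) l) ≤ S :=
    sliceSobolevEnergy_mono _ _ _ _ _ (subset_univ _)
  have h2 : ∀ i ∈ Finset.range (k + 1),
      graphSliceEnergyOn (Kerr.exterior M a) (timeDeriv^[i] ψ) F 0 {y | l < ‖y‖} ≤ 32 * S := by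
    intro i hi
    have hik : i + 1 ≤ k + 1 := by have := Finset.mem_range.mp hi; omega
    obtain ⟨-, hfar⟩ := hkey a hMa (timeDeriv^[i] ψ) (hψ.timeDeriv_iterate hM.le i)
    calc graphSliceEnergyOn (Kerr.exterior M a) (timeDeriv^[i] ψ) F 0 {y | l < ‖y‖}
        ≤ 8 * sliceEnergy (Kerr.exterior M a) (timeDeriv^[i] ψ) 0 := hfar
      _ ≤ 8 * (4 * sliceSobolevEnergy (Kerr.exterior M a) ψ 0 (i + 1 + (k - i)) 0 univ) := by
          gcongr
          exact sliceEnergy_timeDeriv_iterate_le hψ.contMDiff 0 i (k - i)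
      _ = 32 * S := by
          rw [show i + 1 + (k - i) = k + 1 by omega, ← mul_assoc, hS_def]
          norm_num
  have h3 : ∑ i ∈ Finset.range (k + 1),
      graphSliceEnergyOn (Kerr.exterior M a) (timeDeriv^[i] ψ) F 0 {y | l < ‖y‖} ≤
        ∑ _i ∈ Finset.range (k + 1), 32 * S := Finset.sum_le_sum h2
  rw [Finset.sum_const, Finset.card_range, nsmul_eq_mul] at h3
  refine lt_of_le_of_lt (hCψ a le_rfl ψ hψF) ?_
  refine ENNReal.mul_lt_top hC ?_
  refine lt_of_le_of_lt (add_le_add h1 h3) ?_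
  exact ENNReal.add_lt_top.mpr ⟨hS, ENNReal.mul_lt_top (ENNReal.natCast_lt_top _)
    (ENNReal.mul_lt_top (by simp) hS)⟩

end Literature.Geometry.Lorentzian

end
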